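import Mathlib.Topology.Algebra.Polynomial
import Literature.NumberTheory.Transcendental.KZLocalCalculus

/-!
# `NormalFormPrinciple` (stmt-KontsevichZagierPeriods-3869), line `SketchIdeator1` — registered
# sub-goal `slab_sub_pt_mem_relations`: Newton–Leibniz over the point, as a CERTIFICATE of moves

Pure proof file (`--supports` the crux; siege attempt k20, variation "certificate / decide on the
finite core"). The registered sub-goal `slab_sub_pt_mem_relations` of the `ℚ`-split layer of the
leaf `stub_boxRigidity` (lead seat c3): for rational `α ≤ β`, an interval representation
`N = [(α,β), f]` whose integrand has the `ℚ`-rational primitive `F = P_F/Q_F` on `(α,β)`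
(`Q_F ≠ 0` on `[α,β]`), and the point representation `Z = [pt, F(β) − F(α)]` over `ℝ⁰`,
`[N] − [Z] ∈ KZ.relations`.

The proof is organised as an explicit, finite CERTIFICATE in the sense of
`KZLocalCalculus.lean` (move instances as first-class data `KZ.MoveDatum`, each producing one
generator `δ.rel` of `KZ.relations`):

* `δ₁ : NewtonLeibnizDatum` (rule 3 over the base `ℝ⁰`): `[R] − [Z]`, where `R = [[α,β], f]` is
  the closed slab and the primitive is `z ↦ F(z₀)`;
* `δ₂ : DomainAddDatum` (rule 1a): `[R] − [N] − [E]`, the closed slab being the union of the open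
  slab `N.domain` and the two endpoint hyperplanes `E.domain = {x₀ = α ∨ x₀ = β}` (a null set);
* `δ₃ : DomainAddDatum` (rule 1a, degenerate): `[E] − [E] − [E]`, admissible because
  `E.domain ∩ E.domain = E.domain` is null;

and the finite core — the identity `[N] − [Z] = 1 • δ₁.rel + (−1) • δ₂.rel + 1 • δ₃.rel` in the
free abelian group `KZ.FormalRep` — is decided by normalisation (`abel`). A general lemma
(`sum_zsmul_rel_mem_relations`) turns any such `ℤ`-combination of move instances into a relation.
Only `KZCalculus`/`KZLocalCalculus` and Mathlib are used (no transfer `ℝ¹ ≃ ℝ`, no congruence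
lemmas): integrability on the closed slab is integrability on `N.domain ∪ E.domain` with
`E.domain` null.

Sources: M. Kontsevich, D. Zagier, *Periods* (2001), §1.2 rules (1), (3); J. Bochnak, M. Coste,
M.-F. Roy, *Real Algebraic Geometry* (1998), §2.2 (rational functions are semialgebraic).
No definitions are introduced.
-/

noncomputable section

open MeasureTheory Set
open scoped Polynomial
open Literature.NumberTheory.Transcendental Literature.NumberTheory.Transcendental.KZ
open Literature.ModelTheory.ExponentialFields (IsSemialgebraic isSemialgebraic_setOf_eval_le
  isSemialgebraic_setOf_eval_eq_zero)

namespace Summit.KontsevichZagierPeriods.HurwitzMicroSectors.NormalFormPrinciple.PiBox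

namespace SlabCertK20

/-! ## Certificates of moves -/

/-- **Certificates.** A finite `ℤ`-combination `Σ nᵢ • δᵢ.rel` of the relations produced by move
instances `δᵢ : KZ.MoveDatum` (rules (1a), (1b), (2), (3) with their data) is a relation of the
Kontsevich–Zagier calculus. [cite: KontsevichZagier2001, §1.2] -/
theorem sum_zsmul_rel_mem_relations (l : List (ℤ × MoveDatum)) :
    (l.map fun p => p.1 • p.2.rel).sum ∈ relations := by
  refine list_sum_mem fun x hx => ?_
  obtain ⟨p, -, rfl⟩ := List.mem_map.1 hx
  exact relations.zsmul_mem (MoveDatum.rel_mem_relations p.2) p.1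

/-! ## Semialgebraic and measure-theoretic side conditions in `ℝ¹` -/

/-- The two endpoint hyperplanes `{x₀ = α ∨ x₀ = β} ⊂ ℝ¹` (`α, β ∈ ℚ`) form a `ℚ`-semialgebraic
set: the zero set of `(X₀ − α)(X₀ − β)`. [cite: BochnakCosteRoy1998, §2.1] -/
theorem isSemialgebraic_endpoints (α β : ℚ) :
    IsSemialgebraic ℚ {x : Fin 1 → ℝ | x 0 = α ∨ x 0 = β} := by
  have h := isSemialgebraic_setOf_eval_eq_zero (k := ℚ) (R := ℝ)
    ((MvPolynomial.X 0 - MvPolynomial.C α) * (MvPolynomial.X 0 - MvPolynomial.C β) :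
      MvPolynomial (Fin 1) ℚ)
  simp only [map_mul, map_sub, MvPolynomial.aeval_X, MvPolynomial.aeval_C, eq_ratCast,
    mul_eq_zero, sub_eq_zero] at h
  exact h

/-- The two endpoint hyperplanes `{x₀ = α ∨ x₀ = β} ⊂ ℝ¹` are Lebesgue-null. [folklore] -/
theorem volume_endpoints (α β : ℝ) : volume {x : Fin 1 → ℝ | x 0 = α ∨ x 0 = β} = 0 := by
  have h : ∀ c : ℝ, volume {x : Fin 1 → ℝ | x 0 = c} = 0 := fun c => by
    rw [volume_pi]
    exact Measure.pi_hyperplane _ _ _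
  rw [Set.setOf_or]
  exact measure_union_null (h α) (h β)

/-! ## The move: `[(α,β), F'] − [pt, F(β) − F(α)] ∈ relations`, by certificate -/

/-- **Newton–Leibniz over the point** (registered sub-goal `slab_sub_pt_mem_relations` of crux
stmt-KontsevichZagierPeriods-3869, proved by an explicit certificate of three move instances).
Let `α ≤ β` be rational, `N = [(α,β), f]` an interval representation whose integrand `x ↦ f(x₀)`
is `ℚ`-semialgebraic on the closed slab, and `F = P_F/Q_F` (`P_F, Q_F ∈ ℚ[X]`, `Q_F ≠ 0` on
`[α,β]`) a primitive of `f` on `(α,β)`. Then `[N] − [Z] ∈ relations` for every point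
representation `Z = [pt, F(β) − F(α)]` over `ℝ⁰`. Certificate: with `R = [[α,β], f]` (closed
slab) and `E = R|{x₀ = α ∨ x₀ = β}` (null endpoints),
`[N] − [Z] = ([R] − [Z]) − ([R] − [N] − [E]) + ([E] − [E] − [E])`, one Newton–Leibniz instance
over `ℝ⁰` (rule 3) and two domain-additivity instances (rule 1a).
[cite: KontsevichZagier2001, §1.2 rule (3)] -/
theorem slab_sub_pt_mem_relations {α β : ℚ} (hαβ : α ≤ β) (f : ℝ → ℝ) (PF QF : ℚ[X])
    (hQF : ∀ t ∈ Set.Icc (α:ℝ) β, (Polynomial.aeval t QF : ℝ) ≠ 0)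
    (hderiv : ∀ t ∈ Set.Ioo (α:ℝ) β,
      HasDerivAt (fun u : ℝ => (Polynomial.aeval u PF : ℝ) / Polynomial.aeval u QF) (f t) t)
    (hf : IsSemialgebraicFunOn ℚ {x : Fin 1 → ℝ | x 0 ∈ Set.Icc (α:ℝ) β} (fun x => f (x 0)))
    (N : IntegralRep 1) (hNd : N.domain = {x | x 0 ∈ Set.Ioo (α:ℝ) β})
    (hNi : EqOn N.integrand (fun x => f (x 0)) N.domain)
    (Z : IntegralRep 0) (hZd : Z.domain = univ)
    (hZi : Z.integrand = fun _ => (Polynomial.aeval (β:ℝ) PF : ℝ) / Polynomial.aeval (β:ℝ) QF -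
      (Polynomial.aeval (α:ℝ) PF : ℝ) / Polynomial.aeval (α:ℝ) QF) :
    of N - of Z ∈ relations := by
  -- notation: the primitive, the closed slab `C`, the endpoint set `D`
  set F : ℝ → ℝ := fun u => (Polynomial.aeval u PF : ℝ) / Polynomial.aeval u QF with hF
  set C : Set (Fin 1 → ℝ) := {x | x 0 ∈ Set.Icc (α:ℝ) β} with hC
  set D : Set (Fin 1 → ℝ) := {x | x 0 = (α:ℝ) ∨ x 0 = (β:ℝ)} with hD
  have hαβ' : (α:ℝ) ≤ β := by exact_mod_cast hαβ
  -- the closed slab is `ℚ`-semialgebraic (two polynomial inequalities)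
  have hCsa : IsSemialgebraic ℚ C := by
    have h1 := isSemialgebraic_setOf_eval_le (k := ℚ) (R := ℝ)
      (MvPolynomial.C α : MvPolynomial (Fin 1) ℚ) (MvPolynomial.X 0)
    have h2 := isSemialgebraic_setOf_eval_le (k := ℚ) (R := ℝ)
      (MvPolynomial.X 0 : MvPolynomial (Fin 1) ℚ) (MvPolynomial.C β)
    simp only [MvPolynomial.aeval_X, MvPolynomial.aeval_C, eq_ratCast] at h1 h2
    have hset : C = {x | (α:ℝ) ≤ x 0} ∩ {x | x 0 ≤ (β:ℝ)} := by
      ext x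
      simp [hC]
    rw [hset]
    exact h1.inter h2
  -- the primitive read on the first coordinate is `ℚ`-semialgebraic on the closed slab: it is the
  -- quotient of the polynomials `P_F(X₀)`, `Q_F(X₀)` (`Q_F(X₀) ≠ 0` there)
  have hFsa : IsSemialgebraicFunOn ℚ C (fun z : Fin 1 → ℝ => F (z 0)) := by
    have hX : ∀ (x : Fin 1 → ℝ) (A : ℚ[X]), MvPolynomial.aeval x
        (Polynomial.aeval (MvPolynomial.X 0 : MvPolynomial (Fin 1) ℚ) A) =
          (Polynomial.aeval (x 0) A : ℝ) := fun x A => by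
      rw [← Polynomial.aeval_algHom_apply, MvPolynomial.aeval_X]
    refine (isSemialgebraicFunOn_aeval_div_aeval hCsa
      (Polynomial.aeval (MvPolynomial.X 0 : MvPolynomial (Fin 1) ℚ) PF)
      (Polynomial.aeval (MvPolynomial.X 0 : MvPolynomial (Fin 1) ℚ) QF) fun x hx => ?_).congr
      fun x _ => ?_
    · rw [hX]; exact hQF (x 0) hx
    · simp only [hX, hF]
  have hDsa : IsSemialgebraic ℚ D := isSemialgebraic_endpoints α β
  have hDnull : volume D = 0 := volume_endpoints α β
  -- the closed slab is the open slab plus the two endpoints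
  have hCND : C = N.domain ∪ D := by
    rw [hNd, hC, hD]
    ext x
    simp only [mem_setOf_eq, mem_Icc, mem_Ioo, mem_union]
    constructor
    · rintro ⟨h1, h2⟩
      rcases h1.lt_or_eq with h1 | h1
      · rcases h2.lt_or_eq with h2 | h2
        · exact Or.inl ⟨h1, h2⟩
        · exact Or.inr (Or.inr h2)
      · exact Or.inr (Or.inl h1.symm)
    · rintro (⟨h1, h2⟩ | h | h)
      · exact ⟨h1.le, h2.le⟩
      · rw [h]; exact ⟨le_rfl, hαβ'⟩
      · rw [h]; exact ⟨hαβ', le_rfl⟩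
  have hDC : D ⊆ C := hCND ▸ subset_union_right
  -- integrability of `f(x₀)` on the closed slab: on `N.domain` it is `N.integrand`, `D` is null
  have hfiN : IntegrableOn (fun x : Fin 1 → ℝ => f (x 0)) N.domain :=
    N.integrableOn.congr_fun hNi (IntegralRep.measurableSet_domain_holds N)
  have hfiD : IntegrableOn (fun x : Fin 1 → ℝ => f (x 0)) D := by
    rw [IntegrableOn, Measure.restrict_eq_zero.2 hDnull]
    exact integrable_zero_measure
  have hfiC : IntegrableOn (fun x : Fin 1 → ℝ => f (x 0)) C := by
    rw [hCND]
    exact hfiN.union hfiD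
  -- the closed-slab representation `R = [[α,β], f]` and its restriction `E` to the endpoints
  obtain ⟨R, hRd, hRi⟩ : ∃ R : IntegralRep 1, R.domain = C ∧ R.integrand = fun x => f (x 0) :=
    ⟨⟨C, fun x => f (x 0), hCsa, hf, hfiC⟩, rfl, rfl⟩
  have hDR : D ⊆ R.domain := by rw [hRd]; exact hDC
  set E : IntegralRep 1 := R.restrict D hDsa hDR with hE
  have hs0 : ∀ (x : Fin 0 → ℝ) (t : ℝ), (Fin.snoc x t : Fin 1 → ℝ) 0 = t := fun _ _ => rfl
  -- move instance 1 (rule 3 over `ℝ⁰`): `[R] − [Z]`, primitive `z ↦ F (z 0)`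
  let δ₁ : NewtonLeibnizDatum :=
    { n := 0
      r := R
      r' := Z
      a := fun _ => (α:ℝ)
      b := fun _ => (β:ℝ)
      F := fun z => F (z 0)
      isSemialgebraicFunOn_F := by rw [hRd]; exact hFsa
      isSemialgebraicFunOn_a := by
        simpa using isSemialgebraicFunOn_aeval Z.isSemialgebraic_domain (MvPolynomial.C α)
      isSemialgebraicFunOn_b := by
        simpa using isSemialgebraicFunOn_aeval Z.isSemialgebraic_domain (MvPolynomial.C β)
      a_le_b := fun _ _ => hαβ'
      domain_eq := by
        rw [hRd, hZd, hC]
        ext z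
        simp only [mem_setOf_eq, mem_Icc, mem_univ, true_and, Fin.last_zero]
      continuousOn := fun x _ => by
        simp only [hs0]
        exact (Polynomial.continuous_aeval PF).continuousOn.div
          (Polynomial.continuous_aeval QF).continuousOn hQF
      hasDerivAt := fun x _ t ht => by
        rw [hRi]
        simp only [hs0]
        exact hderiv t ht
      integrand_eq := fun x _ => by
        rw [hZi]
        simp only [hs0]
        rfl }
  -- move instance 2 (rule 1a): `[R] − [N] − [E]`, closed slab = open slab ∪ null endpoints
  let δ₂ : DomainAddDatum :=
    { n := 1
      r := R
      r₁ := N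
      r₂ := E
      domain_eq := by rw [hRd]; exact hCND
      volume_inter := measure_mono_null inter_subset_right hDnull
      eqOn₁ := fun x hx => by rw [hRi]; exact (hNi hx).symm
      eqOn₂ := fun _ _ => rfl }
  -- move instance 3 (rule 1a, degenerate): `[E] − [E] − [E]`, as `E.domain` is null
  let δ₃ : DomainAddDatum :=
    { n := 1
      r := E
      r₁ := E
      r₂ := E
      domain_eq := (union_self _).symm
      volume_inter := by rw [inter_self]; exact hDnull
      eqOn₁ := fun _ _ => rfl
      eqOn₂ := fun _ _ => rfl }
  -- the finite core: `[N] − [Z] = δ₁.rel − δ₂.rel + δ₃.rel` in the free abelian group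
  have hcore : of N - of Z =
      (([((1:ℤ), MoveDatum.newtonLeibniz δ₁), (-1, MoveDatum.domainAdd δ₂),
        (1, MoveDatum.domainAdd δ₃)] : List (ℤ × MoveDatum)).map fun p => p.1 • p.2.rel).sum := by
    simp only [List.map_cons, List.map_nil, List.sum_cons, List.sum_nil, MoveDatum.rel,
      NewtonLeibnizDatum.rel, DomainAddDatum.rel, one_zsmul, neg_smul, add_zero]
    abel
  rw [hcore]
  exact sum_zsmul_rel_mem_relations _

end SlabCertK20

end Summit.KontsevichZagierPeriods.HurwitzMicroSectors.NormalFormPrinciple.PiBox
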